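import Summits.Ventures.Crystal3D.Theorems.StickyWulffConstantStackingLiminfCalibratedProfileBound
import HarnessLib

/-!
# Word-uniform surface rungs `∛338` (from `layerProfile`) and `∛369` (from `layerProfileSharp`)
# — crux `StackingLiminf` (stmt-Ventures-19145), rung ladder (cf-p2 R20 optimal-shape calibration
# with the tangent-line value estimate)

Route `StickyWulffConstant` of the venture `Summits/Ventures/Crystal3D` (cell `crystal3d-full`).
From `profile_bound_cal` (`…CalibratedProfileBound.lean`): for every Hägg word `σ` and every
injective `N`-configuration on `barlowStacking 1 √(2/3) σ`,
`numContacts ≤ 6N − min(3N/5, ∛338·N^{2/3} − 9√N)` (input `layerProfile`, `(c,δ) = (1,0)`;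
`numContacts_le_cbrt338`) and `numContacts ≤ 6N − min(3N/5, ∛369·N^{2/3} − 8√N)` (input
`layerProfileSharp`, `(c,δ) = (√2,1/2)`; `numContacts_le_cbrt369`), with the numerical certificates
`27ω₃₁²B/4 ≥ 338` resp. `≥ 369` (`const_one_ge`, `const_sqrt2_ge`, from `√3, √2, √31` to five
places); ε-forms `stackingLiminf_rung_cbrt338/369` (`∛369 = 7.173` = 94.9 % of the crux's `∛432`;
landed before: `∛320 = 6.84`, p462749).  The ladder's exact ceiling is `7.0324 / 7.3544` (R20,
integral form of L5), not reached here.  WHAT THIS IS NOT: `StackingLiminf`; rung F-C1 not moved.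
-/

noncomputable section

namespace Summit.Ventures.Crystal3D.Theorems.OptimalCalibration

open Finset
open Literature.MathematicalPhysics.StatisticalMechanics (barlowStacking IsHaggSeq)
open Summit.Ventures.Crystal3D.Theorems

/-! ### Numerical constants -/

/-- The constant for `(c, δ) = (1, 0)`: `27 ω₃₁² B/4 ≥ 338`. -/
theorem const_one_ge :
    (338 : ℝ) ≤ 27 * (2 * Real.sqrt 3 + 1 - (0 + Real.sqrt 3 / (2 * Real.sqrt 31)) / Real.sqrt 31) ^ 2 *
      (3 - 2 * 1 / (2 * Real.sqrt 3 + 1)) / 4 := by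
  have sqrt3_ge : (1.73205 : ℝ) ≤ Real.sqrt 3 := by
    rw [show (1.73205 : ℝ) = Real.sqrt (1.73205 ^ 2) by rw [Real.sqrt_sq (by norm_num)]]
    exact Real.sqrt_le_sqrt (by norm_num)
  have sqrt3_le : Real.sqrt 3 ≤ 1.73206 := by
    rw [show (1.73206 : ℝ) = Real.sqrt (1.73206 ^ 2) by rw [Real.sqrt_sq (by norm_num)]]
    exact Real.sqrt_le_sqrt (by norm_num)
  have h3 := sqrt3_ge; have h3' := sqrt3_le
  have hs31 : 0 < Real.sqrt 31 := Real.sqrt_pos.2 (by norm_num)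
  have h31 : Real.sqrt 31 * Real.sqrt 31 = 31 := Real.mul_self_sqrt (by norm_num)
  have hω : 2 * Real.sqrt 3 + 1 - (0 + Real.sqrt 3 / (2 * Real.sqrt 31)) / Real.sqrt 31 =
      1 + Real.sqrt 3 * (123 / 62) := by
    field_simp
    nlinarith [h31]
  rw [hω]
  have hωlo : (4.436 : ℝ) ≤ 1 + Real.sqrt 3 * (123 / 62) := by nlinarith
  have hB : (2.5519 : ℝ) ≤ 3 - 2 * 1 / (2 * Real.sqrt 3 + 1) := by
    rw [show 2 * (1 : ℝ) / (2 * Real.sqrt 3 + 1) = 2 / (2 * Real.sqrt 3 + 1) by ring]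
    rw [le_sub_comm, div_le_iff₀ (by positivity)]
    nlinarith
  have hsq : (4.436 : ℝ) ^ 2 ≤ (1 + Real.sqrt 3 * (123 / 62)) ^ 2 :=
    pow_le_pow_left₀ (by norm_num) hωlo 2
  nlinarith [mul_le_mul hsq hB (by norm_num) (by positivity)]

/-- The constant for `(c, δ) = (√2, 1/2)`: `27 ω₃₁² B/4 ≥ 369`. -/
theorem const_sqrt2_ge :
    (369 : ℝ) ≤ 27 * (2 * Real.sqrt 3 + Real.sqrt 2 -
        (1 / 2 + Real.sqrt 3 / (2 * Real.sqrt 31)) / Real.sqrt 31) ^ 2 *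
      (3 - 2 * Real.sqrt 2 / (2 * Real.sqrt 3 + Real.sqrt 2)) / 4 := by
  have sqrt3_ge : (1.73205 : ℝ) ≤ Real.sqrt 3 := by
    rw [show (1.73205 : ℝ) = Real.sqrt (1.73205 ^ 2) by rw [Real.sqrt_sq (by norm_num)]]
    exact Real.sqrt_le_sqrt (by norm_num)
  have sqrt3_le : Real.sqrt 3 ≤ 1.73206 := by
    rw [show (1.73206 : ℝ) = Real.sqrt (1.73206 ^ 2) by rw [Real.sqrt_sq (by norm_num)]]
    exact Real.sqrt_le_sqrt (by norm_num)
  have sqrt2_ge : (1.41421 : ℝ) ≤ Real.sqrt 2 := by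
    rw [show (1.41421 : ℝ) = Real.sqrt (1.41421 ^ 2) by rw [Real.sqrt_sq (by norm_num)]]
    exact Real.sqrt_le_sqrt (by norm_num)
  have sqrt2_le : Real.sqrt 2 ≤ 1.41422 := by
    rw [show (1.41422 : ℝ) = Real.sqrt (1.41422 ^ 2) by rw [Real.sqrt_sq (by norm_num)]]
    exact Real.sqrt_le_sqrt (by norm_num)
  have sqrt31_ge : (5.5677 : ℝ) ≤ Real.sqrt 31 := by
    rw [show (5.5677 : ℝ) = Real.sqrt (5.5677 ^ 2) by rw [Real.sqrt_sq (by norm_num)]]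
    exact Real.sqrt_le_sqrt (by norm_num)
  have h3 := sqrt3_ge; have h3' := sqrt3_le; have h2 := sqrt2_ge; have h2' := sqrt2_le
  have h31g := sqrt31_ge
  have hs31 : 0 < Real.sqrt 31 := Real.sqrt_pos.2 (by norm_num)
  have h31 : Real.sqrt 31 * Real.sqrt 31 = 31 := Real.mul_self_sqrt (by norm_num)
  -- `ω₃₁ = 2√3 + √2 − 1/(2√31) − √3/62`
  have hω : 2 * Real.sqrt 3 + Real.sqrt 2 - (1 / 2 + Real.sqrt 3 / (2 * Real.sqrt 31)) / Real.sqrt 31 =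
      2 * Real.sqrt 3 + Real.sqrt 2 - 1 / (2 * Real.sqrt 31) - Real.sqrt 3 / 62 := by
    field_simp
    nlinarith [h31]
  rw [hω]
  have hinv : 1 / (2 * Real.sqrt 31) ≤ 0.0899 := by
    rw [div_le_iff₀ (by positivity)]; nlinarith
  have hωlo : (4.7604 : ℝ) ≤ 2 * Real.sqrt 3 + Real.sqrt 2 - 1 / (2 * Real.sqrt 31) - Real.sqrt 3 / 62 := by
    nlinarith
  have hB : (2.4202 : ℝ) ≤ 3 - 2 * Real.sqrt 2 / (2 * Real.sqrt 3 + Real.sqrt 2) := by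
    rw [le_sub_comm, div_le_iff₀ (by positivity)]
    nlinarith
  have hsq : (4.7604 : ℝ) ^ 2 ≤ (2 * Real.sqrt 3 + Real.sqrt 2 - 1 / (2 * Real.sqrt 31) - Real.sqrt 3 / 62) ^ 2 :=
    pow_le_pow_left₀ (by norm_num) hωlo 2
  nlinarith [mul_le_mul hsq hB (by norm_num) (by positivity)]

/-- `K^{1/3}·N^{2/3} ≤ 3N/5` once `125K/27 ≤ N` (cube both sides). -/
theorem cbrt_rpow_le {K N : ℝ} (hK : 0 ≤ K) (hN : 125 * K / 27 ≤ N) :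
    K ^ ((1 : ℝ) / 3) * N ^ ((2 : ℝ) / 3) ≤ 3 / 5 * N := by
  have hN0 : 0 ≤ N := le_trans (by positivity) hN
  have h1 : (K ^ ((1 : ℝ) / 3) * N ^ ((2 : ℝ) / 3)) ^ 3 = K * N ^ 2 := by
    rw [mul_pow, ← Real.rpow_natCast, ← Real.rpow_natCast (N ^ ((2 : ℝ) / 3)),
      ← Real.rpow_mul hK, ← Real.rpow_mul hN0]
    norm_num
  have h2 : K * N ^ 2 ≤ (3 / 5 * N) ^ 3 := by nlinarith [sq_nonneg N]
  have h3 : (K ^ ((1 : ℝ) / 3) * N ^ ((2 : ℝ) / 3)) ^ 3 ≤ (3 / 5 * N) ^ 3 := h1 ▸ h2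
  exact (pow_le_pow_iff_left₀ (by positivity) (by positivity) (by norm_num : (3 : ℕ) ≠ 0)).1 h3

/-! ### The rungs -/

/-- **Rung `∛338` from `layerProfile`** (`(c, δ) = (1, 0)`): for every Hägg word `σ` and every
injective configuration on `barlowStacking 1 √(2/3) σ`,
`numContacts x ≤ 6N − min(3N/5, ∛338·N^{2/3} − 9√N)`. -/
theorem numContacts_le_cbrt338 (σ : ℤ → ℤ) (hσ : IsHaggSeq σ) {N : ℕ}
    (x : Fin N → EuclideanSpace ℝ (Fin 3)) (hx : Function.Injective x)
    (hmem : ∀ i, x i ∈ barlowStacking 1 (Real.sqrt (2 / 3)) σ) :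
    (numContacts x : ℝ) ≤ 6 * (N : ℝ) -
      min (3 / 5 * (N : ℝ)) ((338 : ℝ) ^ ((1 : ℝ) / 3) * (N : ℝ) ^ ((2 : ℝ) / 3) - 9 * Real.sqrt N) := by
  rcases Nat.eq_zero_or_pos N with rfl | hNpos
  · have h0 : numContacts x = 0 := by
      rw [numContacts, contactPairs, Finset.card_eq_zero, Finset.filter_eq_empty_iff]
      intro p; exact Fin.elim0 p.1
    rw [h0]; simp [Real.zero_rpow (by norm_num : (2 : ℝ) / 3 ≠ 0)]
  obtain ⟨kmin, kmax, n, d, b, hkk, hsupp, hsum, hd0, hd, hb1, hb2, hC⟩ :=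
    layerProfile σ hσ x hx hmem hNpos
  have hb2' : ∀ κ, 1 / 2 * |(n κ : ℝ) - n (κ + 1)| + 1 * Real.sqrt (max (n κ : ℝ) (n (κ + 1))) - 0
      ≤ b κ := fun κ => by simpa only [one_mul, sub_zero] using hb2 κ
  have h := profile_bound_cal hNpos (c := 1) (δ := 0) one_pos (by norm_num) le_rfl zero_le_one
    (by norm_num) hkk hsupp hsum hd0 hd hb1 hb2' hC
  -- compare the constants
  have hP : (0 : ℝ) ≤ (N : ℝ) ^ ((2 : ℝ) / 3) := by positivity
  have hK : (338 : ℝ) ^ ((1 : ℝ) / 3) ≤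
      (27 * (2 * Real.sqrt 3 + 1 - (0 + Real.sqrt 3 / (2 * Real.sqrt 31)) / Real.sqrt 31) ^ 2 *
        (3 - 2 * 1 / (2 * Real.sqrt 3 + 1)) / 4) ^ ((1 : ℝ) / 3) :=
    Real.rpow_le_rpow (by norm_num) const_one_ge (by norm_num)
  have hK' : 2 * Real.sqrt 3 / 1 + 1 + 2 + (2 * Real.sqrt 3 + 1) / (2 * 1) ≤ 9 := by
    have sqrt3_le : Real.sqrt 3 ≤ 1.73206 := by
      rw [show (1.73206 : ℝ) = Real.sqrt (1.73206 ^ 2) by rw [Real.sqrt_sq (by norm_num)]]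
      exact Real.sqrt_le_sqrt (by norm_num)
    have := sqrt3_le; rw [div_one]; nlinarith
  have hsN : 0 ≤ Real.sqrt (N : ℝ) := Real.sqrt_nonneg _
  have hcmp : (338 : ℝ) ^ ((1 : ℝ) / 3) * (N : ℝ) ^ ((2 : ℝ) / 3) - 9 * Real.sqrt N ≤
      (27 * (2 * Real.sqrt 3 + 1 - (0 + Real.sqrt 3 / (2 * Real.sqrt 31)) / Real.sqrt 31) ^ 2 *
          (3 - 2 * 1 / (2 * Real.sqrt 3 + 1)) / 4) ^ ((1 : ℝ) / 3) * (N : ℝ) ^ ((2 : ℝ) / 3) -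
        (2 * Real.sqrt 3 / 1 + 1 + 2 + (2 * Real.sqrt 3 + 1) / (2 * 1)) * Real.sqrt N := by
    nlinarith [mul_le_mul_of_nonneg_right hK hP, mul_le_mul_of_nonneg_right hK' hsN]
  have hmin := min_le_min (le_refl (3 / 5 * (N : ℝ))) hcmp
  linarith [hmin, h]

/-- **Rung `∛369` from `layerProfileSharp`** (`(c, δ) = (√2, 1/2)`):
`numContacts x ≤ 6N − min(3N/5, ∛369·N^{2/3} − 8√N)`, uniformly in the Hägg word. -/
theorem numContacts_le_cbrt369 (σ : ℤ → ℤ) (hσ : IsHaggSeq σ) {N : ℕ}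
    (x : Fin N → EuclideanSpace ℝ (Fin 3)) (hx : Function.Injective x)
    (hmem : ∀ i, x i ∈ barlowStacking 1 (Real.sqrt (2 / 3)) σ) :
    (numContacts x : ℝ) ≤ 6 * (N : ℝ) -
      min (3 / 5 * (N : ℝ)) ((369 : ℝ) ^ ((1 : ℝ) / 3) * (N : ℝ) ^ ((2 : ℝ) / 3) - 8 * Real.sqrt N) := by
  rcases Nat.eq_zero_or_pos N with rfl | hNpos
  · have h0 : numContacts x = 0 := by
      rw [numContacts, contactPairs, Finset.card_eq_zero, Finset.filter_eq_empty_iff]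
      intro p; exact Fin.elim0 p.1
    rw [h0]; simp [Real.zero_rpow (by norm_num : (2 : ℝ) / 3 ≠ 0)]
  obtain ⟨kmin, kmax, n, d, b, hkk, hsupp, hsum, hd0, hd, hb1, hb2, hC⟩ :=
    layerProfileSharp σ hσ x hx hmem hNpos
  have hb2' : ∀ κ, 1 / 2 * |(n κ : ℝ) - n (κ + 1)| +
      Real.sqrt 2 * Real.sqrt (max (n κ : ℝ) (n (κ + 1))) - 1 / 2 ≤ b κ := by
    intro κ
    have h := hb2 κ
    rw [Real.sqrt_mul (by norm_num : (0 : ℝ) ≤ 2)] at h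
    linarith
  have sqrt2_ge : (1.41421 : ℝ) ≤ Real.sqrt 2 := by
    rw [show (1.41421 : ℝ) = Real.sqrt (1.41421 ^ 2) by rw [Real.sqrt_sq (by norm_num)]]
    exact Real.sqrt_le_sqrt (by norm_num)
  have sqrt2_le : Real.sqrt 2 ≤ 1.41422 := by
    rw [show (1.41422 : ℝ) = Real.sqrt (1.41422 ^ 2) by rw [Real.sqrt_sq (by norm_num)]]
    exact Real.sqrt_le_sqrt (by norm_num)
  have sqrt3_le : Real.sqrt 3 ≤ 1.73206 := by
    rw [show (1.73206 : ℝ) = Real.sqrt (1.73206 ^ 2) by rw [Real.sqrt_sq (by norm_num)]]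
    exact Real.sqrt_le_sqrt (by norm_num)
  have hs2 := sqrt2_ge; have hs2' := sqrt2_le
  have h := profile_bound_cal hNpos (c := Real.sqrt 2) (δ := 1 / 2) (by positivity)
    (by nlinarith) (by norm_num) (by nlinarith) (by nlinarith) hkk hsupp hsum hd0 hd hb1 hb2' hC
  have hP : (0 : ℝ) ≤ (N : ℝ) ^ ((2 : ℝ) / 3) := by positivity
  have hK : (369 : ℝ) ^ ((1 : ℝ) / 3) ≤
      (27 * (2 * Real.sqrt 3 + Real.sqrt 2 -
          (1 / 2 + Real.sqrt 3 / (2 * Real.sqrt 31)) / Real.sqrt 31) ^ 2 *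
        (3 - 2 * Real.sqrt 2 / (2 * Real.sqrt 3 + Real.sqrt 2)) / 4) ^ ((1 : ℝ) / 3) :=
    Real.rpow_le_rpow (by norm_num) const_sqrt2_ge (by norm_num)
  have hK' : 2 * Real.sqrt 3 / Real.sqrt 2 + Real.sqrt 2 + 2 +
      (2 * Real.sqrt 3 + Real.sqrt 2) / (2 * Real.sqrt 2) ≤ 8 := by
    have h3' := sqrt3_le
    have hs2pos : 0 < Real.sqrt 2 := by linarith
    have p1 : 2 * Real.sqrt 3 / Real.sqrt 2 ≤ 2.46 := by
      rw [div_le_iff₀ hs2pos]; nlinarith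
    have p2 : (2 * Real.sqrt 3 + Real.sqrt 2) / (2 * Real.sqrt 2) ≤ 1.73 := by
      rw [div_le_iff₀ (by positivity)]; nlinarith
    linarith
  have hsN : 0 ≤ Real.sqrt (N : ℝ) := Real.sqrt_nonneg _
  have hcmp : (369 : ℝ) ^ ((1 : ℝ) / 3) * (N : ℝ) ^ ((2 : ℝ) / 3) - 8 * Real.sqrt N ≤
      (27 * (2 * Real.sqrt 3 + Real.sqrt 2 -
            (1 / 2 + Real.sqrt 3 / (2 * Real.sqrt 31)) / Real.sqrt 31) ^ 2 *
          (3 - 2 * Real.sqrt 2 / (2 * Real.sqrt 3 + Real.sqrt 2)) / 4) ^ ((1 : ℝ) / 3) *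
          (N : ℝ) ^ ((2 : ℝ) / 3) -
        (2 * Real.sqrt 3 / Real.sqrt 2 + Real.sqrt 2 + 2 +
          (2 * Real.sqrt 3 + Real.sqrt 2) / (2 * Real.sqrt 2)) * Real.sqrt N := by
    nlinarith [mul_le_mul_of_nonneg_right hK hP, mul_le_mul_of_nonneg_right hK' hsN]
  have hmin := min_le_min (le_refl (3 / 5 * (N : ℝ))) hcmp
  linarith [hmin, h]

/-- **The `∛369` rung in the shape of the crux `StackingLiminf`** (`∛369 = 7.173…`, vs `∛432 =
7.5595…`): for every `ε > 0` there is `N₀`, independent of the Hägg word, such that every injective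
`N`-point configuration (`N ≥ N₀`) on any Barlow stacking has `(∛369 − ε)N^{2/3} ≤ 6N − numContacts`. -/
theorem stackingLiminf_rung_cbrt369 :
    ∀ ε : ℝ, 0 < ε → ∃ N₀ : ℕ, ∀ N : ℕ, N₀ ≤ N → ∀ σ : ℤ → ℤ, IsHaggSeq σ →
      ∀ x : Fin N → EuclideanSpace ℝ (Fin 3), Function.Injective x →
        (∀ i, x i ∈ barlowStacking 1 (Real.sqrt (2 / 3)) σ) →
          ((369 : ℝ) ^ ((1 : ℝ) / 3) - ε) * (N : ℝ) ^ ((2 : ℝ) / 3) ≤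
            6 * (N : ℝ) - (numContacts x : ℝ) := by
  intro ε hε
  obtain ⟨N₁, hN₁⟩ := exists_nat_ge ((1 / (ε / 8)) ^ 6)
  refine ⟨max 1709 N₁, fun N hN σ hσ x hx hmem => ?_⟩
  have hmain := numContacts_le_cbrt369 σ hσ x hx hmem
  have hN1 : (1709 : ℝ) ≤ N := by exact_mod_cast (le_max_left _ _).trans hN
  have hN2 : (1 / (ε / 8)) ^ 6 ≤ (N : ℝ) :=
    hN₁.trans (by exact_mod_cast (le_max_right _ _).trans hN)
  have hP : (0 : ℝ) ≤ (N : ℝ) ^ ((2 : ℝ) / 3) := by positivity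
  have hA := cbrt_rpow_le (K := 369) (N := (N : ℝ)) (by norm_num) (by linarith)
  have hB := sqrt_le_eps_mul_rpow (by positivity : 0 < ε / 8) hN2
  rcases min_cases (3 / 5 * (N : ℝ))
      ((369 : ℝ) ^ ((1 : ℝ) / 3) * (N : ℝ) ^ ((2 : ℝ) / 3) - 8 * Real.sqrt N) with
    ⟨h, _⟩ | ⟨h, _⟩
  · rw [h] at hmain; nlinarith
  · rw [h] at hmain; nlinarith

/-- **The `∛338` rung in the shape of the crux** (from `layerProfile` alone, `∛338 = 6.966…`). -/
theorem stackingLiminf_rung_cbrt338 :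
    ∀ ε : ℝ, 0 < ε → ∃ N₀ : ℕ, ∀ N : ℕ, N₀ ≤ N → ∀ σ : ℤ → ℤ, IsHaggSeq σ →
      ∀ x : Fin N → EuclideanSpace ℝ (Fin 3), Function.Injective x →
        (∀ i, x i ∈ barlowStacking 1 (Real.sqrt (2 / 3)) σ) →
          ((338 : ℝ) ^ ((1 : ℝ) / 3) - ε) * (N : ℝ) ^ ((2 : ℝ) / 3) ≤
            6 * (N : ℝ) - (numContacts x : ℝ) := by
  intro ε hε
  obtain ⟨N₁, hN₁⟩ := exists_nat_ge ((1 / (ε / 9)) ^ 6)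
  refine ⟨max 1565 N₁, fun N hN σ hσ x hx hmem => ?_⟩
  have hmain := numContacts_le_cbrt338 σ hσ x hx hmem
  have hN1 : (1565 : ℝ) ≤ N := by exact_mod_cast (le_max_left _ _).trans hN
  have hN2 : (1 / (ε / 9)) ^ 6 ≤ (N : ℝ) :=
    hN₁.trans (by exact_mod_cast (le_max_right _ _).trans hN)
  have hP : (0 : ℝ) ≤ (N : ℝ) ^ ((2 : ℝ) / 3) := by positivity
  have hA := cbrt_rpow_le (K := 338) (N := (N : ℝ)) (by norm_num) (by linarith)
  have hB := sqrt_le_eps_mul_rpow (by positivity : 0 < ε / 9) hN2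
  rcases min_cases (3 / 5 * (N : ℝ))
      ((338 : ℝ) ^ ((1 : ℝ) / 3) * (N : ℝ) ^ ((2 : ℝ) / 3) - 9 * Real.sqrt N) with
    ⟨h, _⟩ | ⟨h, _⟩
  · rw [h] at hmain; nlinarith
  · rw [h] at hmain; nlinarith

end Summit.Ventures.Crystal3D.Theorems.OptimalCalibration

end
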